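import Summits.BirchSwinnertonDyer.BirchSwinnertonDyer.Theorems.ByReductionTypeAtTwoSupersingularFlatLocalDualityMapLinear
import Literature.NumberTheory.EllipticCurves.Sprung2012.FineSelmerLeSharpFlatSelmerProofs
import HarnessLib

/-!
# Route `ByReductionTypeAtTwo` (rung K4), crux `SupersingularRankZeroAtTwo` (item stmt-BirchSwinnertonDyer-19097), line
# `odd_blind_package`, stub `stub_flatPackage`, conjunct (8), clause F1♭ — **THE CONTRACT's `toX : Λ →ₗ[Λ] X♭` FOR A CONTRAGREDIENT
# PIN** (descent of the `Λ`-linear ♭ local duality map `ν` of `…FlatLocalDualityMapLinear` along a `Λ`-linear ♭ Coleman map onto `Λ`;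
# any number field `K`, prime `p`, `ℤ_p`-extension, place `v`, generator pair `(γ, g)`; cell `bsd-2adic`, seat `bsd-2adic-tower-1`
# GEN 67, hand H2-F1F3; repair (R1) of the pen's RC-800; `--supports 19097`, helper)

HONEST FRAMING (D-0054): THEOREMS ONLY — no definition, no named fact, no instance, no `sorry`.

Under (R1) «contragredient keying» conjunct (8) keeps `I : IwasawaH1Data W 2 κ γ`, `P : Submodule Λ Λ`, `loc : I.H →ₗ[Λ] P` and all
three maps `Λ`-LINEAR, and re-keys only the dual data: `D : SharpFlatSelmerDualData W κ γ⁻¹ …`, `Y : W.FineSelmerDualData κ γ⁻¹`.  This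
file delivers the displayed witness `toX` on `P := ⊤`: `toX : Λ →ₗ[Λ] D.X` with `toX (Col♭ w) = ν w` (so `toX ∘ (Col♭ ∘ pairFun I)` is the
print Poitou–Tate map `𝐇¹ → X♭`), its values on Kummer data, and `range toX ⊆ ker δ` for every transpose `δ : D.X → Y.X` of `Sel₀ ≤ Sel♭`
(e.g. the `Λ`-linear surjection of `Sprung2012.SharpFlatSelmerDualData.exists_linearMap_toFineDual`).  `Function.Exact loc toX` and
`Exact toX δ` (Poitou–Tate) are NOT claimed.  Closes NO stub; 19097 OPEN; nothing booked; BSD is proved for no curve; typed ≠ proved.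

References: [Kobayashi2003] (7.17)–(7.21) (p. 12); [Sprung2012] Def. 7.9, 7.11 (p. 1503), Prop. 7.3 (p. 1500), Prop. 7.19 (p. 1505);
[GreenbergLNM1716] §1 p. 60; [Greenberg1989] pp. 101–102.
-/

set_option autoImplicit false
-- the Theorems namespace of this sub repeats the summit name by design (D-0017 nested layout)
set_option linter.dupNamespace false

noncomputable section

open scoped Classical NumberField

universe u

namespace Summit.BirchSwinnertonDyer.BirchSwinnertonDyer.Theorems

namespace SSFlatPackage

open NumberField IsDedekindDomain Field WeierstrassCurve Literature.NumberTheory.EllipticCurves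
  Literature.NumberTheory.EllipticCurves.Sprung2012 Literature.NumberTheory.EllipticCurves.Sprung2017
  Literature.NumberTheory.EllipticCurves.Kobayashi2003 Literature.NumberTheory.EllipticCurves.IwasawaDual
  Literature.NumberTheory.EllipticCurves.GreenbergSelmer Literature.NumberTheory.GaloisRepresentations
  Literature.Algebra.Module ZpExtension

variable {K : Type u} [Field K] [NumberField K] (W : WeierstrassCurve K) {p : ℕ} [hp : Fact p.Prime]
  (κ : ZpExtension K p) {γ : absoluteGaloisGroup K} (v : HeightOneSpectrum (𝓞 K)) {ap : ℤ}
  {g : absoluteGaloisGroup (v.adicCompletion K)} {c : ℕ → localPoints W (v.adicCompletion K)}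

/-- ★ **The contract's `toX : Λ →ₗ[Λ] X♭` for a contragredient pin.**  For `κ γ = κ(res g) = 1`, `γ δ = 1`, `p ∣ a_p`, a `Λ`-LINEAR
♭ Coleman family `J` (`Col(z) = J z`, structure `moduleOfGenerator`) whose ♭ component `Col♭ = (J ·).2` is ONTO `Λ`, and a ♭ dual datum
`D` of key `δ`: there is a `Λ`-LINEAR `toX : Λ →ₗ[Λ] D.X` (the descent of `ν` to `Λ ≅ H¹_Iw(K_v,T)/Ker Col♭`, i.e. on `P := ⊤`) with
(V̄) `D.toDual (toX (Col♭ w)) s = w(p^kQ)/p^k mod ℤ` for every functional `w` and Kummer datum `(φ, Q, k)` of `s ∈ Sel♭` at `v`;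
(Z̄) `toX f` kills `Sel₀(K_∞, E[p^∞])`; (δ̄) `kk (toX f) = 0` for every additive `kk : D.X → Y.X` transposing `Sel₀ ≤ Sel♭` into ANY fine
pin `Y` (e.g. the `Λ`-linear surjection of `SharpFlatSelmerDualData.exists_linearMap_toFineDual`) — `range toX ⊆ ker δ`.
The equality `range toX = ker δ` and `ker toX = Col♭(loc 𝐇¹)` (Poitou–Tate) are NOT asserted.
[cite: Kobayashi2003, (7.17)–(7.21) (p. 12)] [cite: Sprung2012, Def. 7.9, Def. 7.11 (p. 1503), Prop. 7.3 (p. 1500), Prop. 7.19 (p. 1505)]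
[cite: GreenbergLNM1716, §1 p. 60] [cite: Greenberg1989, pp. 101–102] -/
theorem exists_flatToXLinearMap_of_mul_eq_one [W.IsElliptic] (hγ : κ.IsTopGenerator γ) {δ : absoluteGaloisGroup K} (hγδ : γ * δ = 1)
    (hg : κ.IsTopGenerator (resGalOfEmb (closureEmb (K := K) (v.adicCompletion K)) g)) (hap : (p : ℤ) ∣ ap)
    (J : letI := moduleOfGenerator κ (closureEmb (K := K) (v.adicCompletion K)) W hg
      (localTowerPointsOfEmb κ (closureEmb (K := K) (v.adicCompletion K)) W →+ ℤ_[p]) →ₗ[IwasawaAlgebra p]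
        IwasawaAlgebra p × IwasawaAlgebra p)
    (hJ : ∀ z, IsColemanPair κ (closureEmb (K := K) (v.adicCompletion K)) W ap g c z (J z).1 (J z).2)
    (hsurj : ∀ f : IwasawaAlgebra p, ∃ w, (J w).2 = f)
    (D : SharpFlatSelmerDualData W κ δ (closureEmb (K := K) (v.adicCompletion K)) ap g c .flat) :
    ∃ toX : IwasawaAlgebra p →ₗ[IwasawaAlgebra p] D.X,
      (∀ (w : localTowerPointsOfEmb κ (closureEmb (K := K) (v.adicCompletion K)) W →+ ℤ_[p])
          (s : sharpFlatSelmerInfty W κ (closureEmb (K := K) (v.adicCompletion K)) ap g c .flat)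
          (φ : contOneCocycles.{0, u} (discreteTopRep κ.kerSubgroup (W.geomPrimaryTorsion p)))
          (Q : localPoints W (v.adicCompletion K)) (k : ℕ)
          (hQ : (p ^ k) • Q ∈ localTowerPointsOfEmb κ (closureEmb (K := K) (v.adicCompletion K)) W),
          oneCocycleClass (discreteTopRep κ.kerSubgroup (W.geomPrimaryTorsion p)) φ = (s : W.subgroupH1 p κ.kerSubgroup) →
          (∀ τ : localSubgroupOfEmb κ.kerSubgroup (closureEmb (K := K) (v.adicCompletion K)),
            pointsMapOfEmb W (closureEmb (K := K) (v.adicCompletion K))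
                ((φ.1 (resGalSubgroupOfEmb κ.kerSubgroup _ τ) : W.geomPrimaryTorsion p) : W.geomPoints) =
              (τ : absoluteGaloisGroup (v.adicCompletion K)) • Q - Q) →
          ∀ a : ℤ, PadicInt.toZModPow k (w ⟨(p ^ k) • Q, hQ⟩) = (a : ZMod (p ^ k)) →
            D.toDual (toX (J w).2) s = (((a : ℚ) / (p : ℚ) ^ k : ℚ) : AddCircle (1 : ℚ))) ∧
      (∀ (f : IwasawaAlgebra p) (s : sharpFlatSelmerInfty W κ (closureEmb (K := K) (v.adicCompletion K)) ap g c .flat),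
          (s : W.subgroupH1 p κ.kerSubgroup) ∈ W.fineSelmerInfty κ → D.toDual (toX f) s = 0) ∧
      (∀ {γ' : absoluteGaloisGroup K} (Y : W.FineSelmerDualData κ γ') (kk : D.X →+ Y.X),
          (∀ (x : D.X) (s : W.fineSelmerInfty κ),
            Y.toDual (kk x) s = D.toDual x (AddSubgroup.inclusion (fineSelmerInfty_le_sharpFlatSelmerInfty W κ v ap g c .flat) s)) →
          ∀ f, kk (toX f) = 0) := by
  letI inst := moduleOfGenerator κ (closureEmb (K := K) (v.adicCompletion K)) W hg
  obtain ⟨ν, hV, hK, hZ⟩ := exists_flatLocalDualityLinearMap_of_mul_eq_one W κ v hγ hγδ hg hap (fun z ↦ J z)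
    (Js := fun z ↦ (J z).1) hJ D
  -- `ν` is constant on the fibres of `Col♭`
  have hwd : ∀ w w', (J w).2 = (J w').2 → ν w = ν w' := by
    intro w w' h
    rw [← sub_eq_zero, ← map_sub]
    exact hK _ (by rw [map_sub, Prod.snd_sub, h, sub_self])
  choose lift hlift using hsurj
  have h0 : ν (lift 0) = 0 := by
    have h := hwd (lift 0) 0 (by rw [hlift, map_zero, Prod.snd_zero])
    rw [h, map_zero]
  have hadd : ∀ f f', ν (lift (f + f')) = ν (lift f) + ν (lift f') := fun f f' ↦ by
    have h := hwd (lift (f + f')) (lift f + lift f') (by rw [hlift, map_add, Prod.snd_add, hlift, hlift])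
    rw [h, map_add]
  have hsmul : ∀ (f a : IwasawaAlgebra p), ν (lift (f • a)) = f • ν (lift a) := fun f a ↦ by
    have h := hwd (lift (f • a)) (f • lift a) (by rw [hlift, map_smul, Prod.smul_snd, hlift])
    rw [h, map_smul]
  let toX : IwasawaAlgebra p →ₗ[IwasawaAlgebra p] D.X :=
    { toFun := fun f ↦ ν (lift f)
      map_add' := hadd
      map_smul' := hsmul }
  have htoX : ∀ w, toX (J w).2 = ν w := fun w ↦ hwd _ _ (hlift _)
  have htoX' : ∀ f, toX f = ν (lift f) := fun f ↦ rfl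
  refine ⟨toX, fun w s φ Q k hQ hφ hτ a ha ↦ by rw [htoX]; exact hV w s φ Q k hQ hφ hτ a ha,
    fun f s hs ↦ by rw [htoX']; exact hZ (lift f) s hs, fun Y kk hkk f ↦ ?_⟩
  -- (δ̄): `Y.toDual` is injective and `kk (toX f)` vanishes on `Sel₀`
  apply Y.bijective.1
  rw [map_zero]
  refine AddMonoidHom.ext fun s ↦ ?_
  rw [hkk, AddMonoidHom.zero_apply, htoX']
  -- the membership of the included class, WITHOUT asking the kernel to compare the two carriers
  have hs : ((AddSubgroup.inclusion (fineSelmerInfty_le_sharpFlatSelmerInfty W κ v ap g c .flat) s :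
      sharpFlatSelmerInfty W κ (closureEmb (K := K) (v.adicCompletion K)) ap g c .flat) :
        W.subgroupH1 p κ.kerSubgroup) ∈ W.fineSelmerInfty κ := by
    rw [AddSubgroup.coe_inclusion]
    exact s.2
  exact hZ (lift f) _ hs

end SSFlatPackage

end Summit.BirchSwinnertonDyer.BirchSwinnertonDyer.Theorems

end
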